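import Literature.MathematicalPhysics.QuantumFieldTheory.Balaban1983to89.B11Ineq73KernelLettersUniform
import Literature.MathematicalPhysics.QuantumFieldTheory.Balaban1983to89.B11Eq79LinearTerm
import Literature.Analysis.Complex.HolomorphicBanach

/-!
# `Balaban1983to89.B11Eq79LinearTermUniform` — T. Bałaban, *The variational problem and background fields in renormalization group method for
# lattice gauge theories*, Commun. Math. Phys. **102** (1985) 277–309 [Balaban1985Variational]: (79) p. 290, (56) p. 286, (46) p. 285, (28) p. 282 — THE
# SIZE OF THE LINEAR CURRENT `L_J(A′) = −((HC⁽²⁾)′(A′))ᵗJ` OF (79) IN CLOSED FORM IN THE BOUNDS: `‖L_J‖ ≤ 4κ̄(M_D)·b·C₂·‖ρ‖‖tr‖·‖J‖₍₋₃₎` for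
# every carrier (115) with `‖∇g‖ ≤ M_D‖g‖`, every `H`, `C` of the Sect. C regime — the per-datum finite-dimensionality bound
# `NE9CurChartOneInstance.exists_norm_comp_LJ_le` replaced by Cauchy's inequality for `D²C(0)`

statement-level skeleton of published theorems with citation tags; proofs where landed; nothing here is a claim about the Yang–Mills mass gap

THE PRINT (verbatim).  p. 290 (78): *«⟨HD(A′), J⟩ = ⟨HC⁽²⁾(A′), J⟩ + ⟨HD₃(A′), J⟩»*; (79) (the next display) absorbs the first summand, quadratic
in `A′`, into the form `Δ₁` («½⟨A′, Δ_πA′⟩ − ⟨HC⁽²⁾(A′), J⟩ = … = ½⟨A′, Δ₁A′⟩»); its derivative in `A′` is the LINEAR current `L_J` of ne9-leaf-05's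
`B11Eq79LinearTerm` («the θ of the scheme's Λ-slot»).  p. 282 (28):
*«|J|₍₋₃₎ < C₁B₃ε₁»* — the current is small; (46) p. 285: the kernel bound of `H`.  WHAT IS PROVED is the bookkeeping that makes the Λ-slot's
contraction `‖𝔊 ∘L L_J‖ ≤ θ̄ < 1` a consequence of ONE smallness `‖J‖₍₋₃₎ ≤ j̄₁` UNIFORM over the data obeying fixed bounds.

WHY THIS FILE (cell context, pub-balaban NE9).  `Support/NE9CurChartOneInstanceUniformBall` §2 (ne9-leaf-05 gen 68) leaves ONE letter displayed:
the linear slot's contraction `θ̄`.  Per datum, `‖𝔊(U) ∘L L_J‖ ≤ K(U)‖J‖` by finite-dimensionality (`exists_norm_comp_LJ_le`); the `U`-dependence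
sits in `‖dQuad C(U)‖` (the polarised `D²C(U)(0)`) and in the column constant `κ(∇_U)`.  Here `‖D²C(0)‖ ≤ 4C₂` by the tree's Cauchy inequality
for iterated Fréchet derivatives (`Literature.Analysis.Complex.HolomorphicBanach.norm_iteratedFDeriv_le_of_closedBall`, [Chae1985] 13.6) from
`Prop4Hyp C C₂ c₄` ALONE, and `κ(∇) ≤ κ̄(M_D)` by `B11Ineq73KernelLettersUniform.colConst_le`; so `θ̄` becomes «`‖J‖ ≤ j̄₁`» with `j̄₁` U-free.

WHAT IS PROVED (sorry-free; no definition; no `Prop` placeholder; nothing of [B11]'s inequalities asserted).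
* §1 **`norm_iteratedFDeriv_two_le_of_quad`** (generic complex normed domain, complete codomain): `‖C(Y)‖ ≤ C₂‖Y‖²`, `0 ≤ C₂`, `DifferentiableOn`
  on `‖Y‖ < c₄` ⇒ `‖D²C(0)‖ ≤ 4C₂` (Cauchy on `closedBall 0 (c₄∕2)` with `δ = c₄∕4`, sup `≤ C₂c₄²∕4`).
* §2 **`norm_dQuad_le`** (`‖dQuad C A′‖ ≤ 4C₂‖A′‖`), **`colSum_kernel_fderiv_HquadPart_le`** (the `θ₂`-binder of `B11Eq79LinearTerm.norm_LJ_le`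
  INHABITED: `Σ_{b′}(w₃(b)/w₃(b′))‖k_{(HC⁽²⁾)′(A′)}(b′,b)‖ ≤ κ(∇)·4bC₂·‖A′‖`), **`norm_LJ_le_explicit`** (`‖L_J‖ ≤ ‖ρ‖‖tr‖·4κ(∇)bC₂·‖J‖`).
* §3 **`exists_norm_LJ_le_uniform`** — `∀ (b C₂ ≥ 0) (0 < a_C) (M_ρ M_τ M_D ≥ 0), ∃ K ≥ 0, ∀ {∇}
  (‖∇g‖ ≤ M_D‖g‖) {H C} (Regime H 0 C b 0 C₂ c₄ 0 a_C ε_C) (Prop4Hyp C C₂ c₄) (ρ tr) (‖ρ‖ ≤ M_ρ) (‖tr‖ ≤ M_τ) (J), ‖LJ ρ tr H C J‖ ≤ K‖J‖` —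
  `K := M_ρ M_τ·4κ̄(M_D)bC₂`.
HONEST SCOPE.  (i) Closed form in per-LATTICE bounds (`κ̄` counts bonds × inverse weights; NO decay — NOT print's θ₂ of (46) with locality).  (ii) NOT
summit progress (cell pub-balaban: NE9 NOT PRINTED ∕ NOT PROVED; «NE9 ⇐ the named binders»; spine PROVED 0∕9; HONEST DEPENDENCY: continuum YM on T⁴ ⇐
BetaPertH ∧ nine spine estimates (0/9 proved); BetaPertH ⇐ (D1) ∧ (D4) ∧ CAP+tail; G-an2-4 gates asym, D1 and NE2/3/4).  Filed by the NE9 crux-team leaf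
seat `b2b-balaban-t4-ne9-formalise-leaf-05` (gen 68); NEW file; imports `B11Ineq73KernelLettersUniform` (this seat), `B11Eq79LinearTerm` (ne9-leaf-05 gen 65),
`Literature.Analysis.Complex.HolomorphicBanach`; nothing modified.  Net new unproved facts: 0.
-/

noncomputable section

open scoped BigOperators
namespace Literature.MathematicalPhysics.QuantumFieldTheory.Balaban1983to89.B11Eq79LinearTermUniform

open Metric Set Filter Topology
open Literature.MathematicalPhysics.QuantumFieldTheory.Balaban1983to89.B11Prop6Scheme (Prop4Hyp)
open Literature.MathematicalPhysics.QuantumFieldTheory.Balaban1983to89.B11Eq174Chart (Regime)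
open Literature.MathematicalPhysics.QuantumFieldTheory.Balaban1983to89.B11Eq90Transpose (kernel single115 transCur norm_transCur_le)
open Literature.MathematicalPhysics.QuantumFieldTheory.Balaban1983to89.B11Eq80Current (quadPart)
open Literature.MathematicalPhysics.QuantumFieldTheory.Balaban1983to89.B11Eq79LinearTerm (d2 dQuad dQuad_apply LJ fderiv_H_quadPart norm_LJ_le)
open Literature.MathematicalPhysics.QuantumFieldTheory.Balaban1983to89.B11Ineq73KernelLettersPerLattice (colSum_kernel_le)
open Literature.MathematicalPhysics.QuantumFieldTheory.Balaban1983to89.B11Ineq73KernelLettersUniform (colConst_le)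
open B9SectCLatticeCarrier (Bond)
open B11Eq115Space

/-! ## §1 Cauchy's inequality for `D²C(0)` from the quadratic bound -/

section Generic

variable {E F : Type*} [NormedAddCommGroup E] [NormedSpace ℂ E] [NormedAddCommGroup F] [NormedSpace ℂ F] [CompleteSpace F]

/-- **`‖D²C(0)‖ ≤ 4C₂`** for a map with `‖C(Y)‖ ≤ C₂‖Y‖²` (`0 ≤ C₂`) complex-differentiable on `‖Y‖ < c₄`: Cauchy's inequality for the second Fréchet
derivative ([Chae1985] 13.6, the tree's `HolomorphicBanach.norm_iteratedFDeriv_le_of_closedBall`) on `closedBall 0 (c₄∕2)` (sup `≤ C₂(c₄∕2)²`) with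
step `δ = c₄∕4`. [cite: Balaban1985Variational, (53)–(56) p.286; Chae1985, 13.6] -/
theorem norm_iteratedFDeriv_two_le_of_quad {C : E → F} {C₂ c₄ : ℝ} (hc₄ : 0 < c₄) (hC₂ : 0 ≤ C₂)
    (hq : ∀ Y : E, ‖Y‖ < c₄ → ‖C Y‖ ≤ C₂ * ‖Y‖ ^ 2) (hd : DifferentiableOn ℂ C {Y : E | ‖Y‖ < c₄}) :
    ‖iteratedFDeriv ℂ 2 C 0‖ ≤ 4 * C₂ := by
  have hU : IsOpen {Y : E | ‖Y‖ < c₄} := isOpen_lt continuous_norm continuous_const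
  have hρU : closedBall (0 : E) (c₄ / 2) ⊆ {Y : E | ‖Y‖ < c₄} := fun z hz => by
    rw [mem_closedBall, dist_zero_right] at hz
    show ‖z‖ < c₄
    linarith
  have hM : ∀ z ∈ closedBall (0 : E) (c₄ / 2), ‖C z‖ ≤ C₂ * (c₄ / 2) ^ 2 := fun z hz => by
    rw [mem_closedBall, dist_zero_right] at hz
    exact (hq z (by linarith)).trans (mul_le_mul_of_nonneg_left (pow_le_pow_left₀ (norm_nonneg _) hz 2) hC₂)
  have h := Literature.Analysis.Complex.HolomorphicBanach.norm_iteratedFDeriv_le_of_closedBall hd hU hρU hM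
    (by positivity : (0 : ℝ) < c₄ / 4) 2 (by push_cast; linarith) (x' := 0) (by
      rw [mem_closedBall, dist_self]; push_cast; linarith)
  refine h.trans (le_of_eq ?_)
  field_simp
  ring

end Generic

/-! ## §2 The `θ₂`-binder of `norm_LJ_le` inhabited in closed form -/

section Slot

variable {𝔸 : Type*} [NormedRing 𝔸] [NormedAlgebra ℂ 𝔸] [FiniteDimensional ℂ 𝔸]
variable {d : ℕ} {Pd : Fin d → ℕ} {L η : ℝ} [Fact (0 < L)] [Fact (0 < η)] {lev₀ : Bond d Pd → ℕ} {κ' : Type*} [Fintype κ']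
  {lev₁ : κ' → ℕ} {Dc : (Bond d Pd → 𝔸) →ₗ[ℂ] (κ' → 𝔸)}
variable {𝒳 : Type*} [NormedAddCommGroup 𝒳] [NormedSpace ℂ 𝒳]
variable {H : 𝒳 →L[ℂ] Space115 L η lev₀ lev₁ Dc} {C : Space115 L η lev₀ lev₁ Dc → 𝒳} {b C₂ c₄ aC εC : ℝ}

omit [FiniteDimensional ℂ 𝔸] in
/-- **`‖dQuad C A′‖ ≤ 4C₂‖A′‖`**: the polarised differential `δ ↦ ½(D²C(0)(A′, δ) + D²C(0)(δ, A′))` of `C⁽²⁾` is bounded by `‖D²C(0)‖·‖A′‖`, and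
`‖D²C(0)‖ ≤ 4C₂` (§1) under `Prop4Hyp C C₂ c₄` (`0 ≤ C₂`, `0 < c₄`). [cite: Balaban1985Variational, (56) p.286, (78) p.290] -/
theorem norm_dQuad_le [CompleteSpace 𝒳] [CompleteSpace 𝔸] (hC : Prop4Hyp C C₂ c₄) (hC₂ : 0 ≤ C₂) (hc₄ : 0 < c₄)
    (A' : Space115 L η lev₀ lev₁ Dc) : ‖dQuad C A'‖ ≤ 4 * C₂ * ‖A'‖ := by
  have h2 : ‖iteratedFDeriv ℂ 2 C 0‖ ≤ 4 * C₂ := norm_iteratedFDeriv_two_le_of_quad hc₄ hC₂ hC.quad hC.differentiableOn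
  have hbil : ∀ v w : Space115 L η lev₀ lev₁ Dc, ‖d2 C v w‖ ≤ 4 * C₂ * (‖v‖ * ‖w‖) := by
    intro v w
    have happ : d2 C v w = iteratedFDeriv ℂ 2 C 0 ![v, w] := by
      rw [d2, iteratedFDeriv_two_apply]; rfl
    rw [happ]
    calc ‖iteratedFDeriv ℂ 2 C 0 ![v, w]‖ ≤ ‖iteratedFDeriv ℂ 2 C 0‖ * ∏ i, ‖(![v, w] : Fin 2 → Space115 L η lev₀ lev₁ Dc) i‖ :=
          (iteratedFDeriv ℂ 2 C 0).le_opNorm _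
      _ = ‖iteratedFDeriv ℂ 2 C 0‖ * (‖v‖ * ‖w‖) := by
          rw [Fin.prod_univ_two]; rfl
      _ ≤ 4 * C₂ * (‖v‖ * ‖w‖) := mul_le_mul_of_nonneg_right h2 (by positivity)
  refine ContinuousLinearMap.opNorm_le_bound _ (by positivity) fun δ' => ?_
  rw [dQuad_apply, norm_smul]
  have h1 := hbil A' δ'
  have h3 := hbil δ' A'
  have hn : ‖(2 : ℂ)⁻¹‖ = 2⁻¹ := by simp
  rw [hn]
  calc 2⁻¹ * ‖d2 C A' δ' + d2 C δ' A'‖ ≤ 2⁻¹ * (‖d2 C A' δ'‖ + ‖d2 C δ' A'‖) := by gcongr; exact norm_add_le _ _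
    _ ≤ 2⁻¹ * (4 * C₂ * (‖A'‖ * ‖δ'‖) + 4 * C₂ * (‖δ'‖ * ‖A'‖)) := by gcongr
    _ = 4 * C₂ * ‖A'‖ * ‖δ'‖ := by ring

/-- **THE `θ₂`-BINDER OF `norm_LJ_le` IN CLOSED FORM**: under the Sect. C regime and `Prop4Hyp C C₂ c₄` (`0 < a_C`), for every `A′` and every bond `b`,
`Σ_{b′}(w₃(b)/w₃(b′))‖k_{(HC⁽²⁾)′(A′)}(b′, b)‖ ≤ κ(∇)·(b·4C₂)·‖A′‖` — `(HC⁽²⁾)′(A′) = H ∘L dQuad C A′` (`fderiv_H_quadPart`), leaf-01's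
`colSum_kernel_le`, `‖H‖ ≤ b`, `‖dQuad C A′‖ ≤ 4C₂‖A′‖`. Print: (46)'s kernel bound of `H` + locality of `C⁽²⁾`, here per lattice (no decay).
[cite: Balaban1985Variational, (46) p.285, (56) p.286, (79) p.290] -/
theorem colSum_kernel_fderiv_HquadPart_le [CompleteSpace 𝒳] [CompleteSpace 𝔸] (RC : Regime H 0 C b 0 C₂ c₄ 0 aC εC) (hC : Prop4Hyp C C₂ c₄)
    (haC : 0 < aC) (A' : Space115 L η lev₀ lev₁ Dc) (bb : Bond d Pd) :
    ∑ b' : Bond d Pd, levWeight L η lev₀ 3 bb / levWeight L η lev₀ 3 b' * ‖kernel (fderiv ℂ (fun Y => H (quadPart C Y)) A') b' bb‖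
      ≤ (∑ bb : Bond d Pd, ∑ b' : Bond d Pd, levWeight L η lev₀ 3 bb / levWeight L η lev₀ 3 b'
            * ‖JetSup.evalCLM (𝕜 := ℂ) (levWeight L η lev₀ 1) (levWeight L η lev₁ 2) Dc b'‖
            * ‖single115 (L := L) (η := η) (lev₀ := lev₀) (lev₁ := lev₁) (Dc := Dc) bb‖)
          * (b * (4 * C₂)) * ‖A'‖ := by
  have hw : ∀ b : Bond d Pd, 0 < levWeight L η lev₀ 3 b := levWeight_pos (Fact.out : 0 < L) (Fact.out : 0 < η) lev₀ 3
  have hκ0 : 0 ≤ ∑ bb : Bond d Pd, ∑ b' : Bond d Pd, levWeight L η lev₀ 3 bb / levWeight L η lev₀ 3 b'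
      * ‖JetSup.evalCLM (𝕜 := ℂ) (levWeight L η lev₀ 1) (levWeight L η lev₁ 2) Dc b'‖
      * ‖single115 (L := L) (η := η) (lev₀ := lev₀) (lev₁ := lev₁) (Dc := Dc) bb‖ :=
    Finset.sum_nonneg fun bb _ => Finset.sum_nonneg fun b' _ => by
      have := (hw bb).le; have := (hw b').le; positivity
  have hc₄ : 0 < c₄ := by linarith [RC.dom, RC.ε₄_nonneg]
  have hHn : ‖H‖ ≤ b := ContinuousLinearMap.opNorm_le_bound _ RC.B₀_nonneg RC.norm_G
  have hop : ‖H.comp (dQuad C A')‖ ≤ b * (4 * C₂) * ‖A'‖ :=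
    calc ‖H.comp (dQuad C A')‖ ≤ ‖H‖ * ‖dQuad C A'‖ := ContinuousLinearMap.opNorm_comp_le _ _
      _ ≤ b * (4 * C₂ * ‖A'‖) := mul_le_mul hHn (norm_dQuad_le hC RC.C₄_nonneg hc₄ A') (norm_nonneg _) RC.B₀_nonneg
      _ = b * (4 * C₂) * ‖A'‖ := by ring
  rw [fderiv_H_quadPart]
  calc _ ≤ _ * ‖H.comp (dQuad C A')‖ := colSum_kernel_le _ bb
    _ ≤ _ * (b * (4 * C₂) * ‖A'‖) := mul_le_mul_of_nonneg_left hop hκ0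
    _ = _ := by ring

/-- **`‖L_J‖ ≤ ‖ρ‖‖tr‖·(κ(∇)·4bC₂)·‖J‖₍₋₃₎`** — `B11Eq79LinearTerm.norm_LJ_le` at the closed-form `θ₂` of `colSum_kernel_fderiv_HquadPart_le`, as an
operator-norm bound. [cite: Balaban1985Variational, (79) p.290, (46) p.285, (28) p.282] -/
theorem norm_LJ_le_explicit [CompleteSpace 𝒳] [CompleteSpace 𝔸] (RC : Regime H 0 C b 0 C₂ c₄ 0 aC εC) (hC : Prop4Hyp C C₂ c₄) (haC : 0 < aC)
    (ρ : (𝔸 →L[ℂ] ℂ) →L[ℂ] 𝔸) (τ : 𝔸 →L[ℂ] ℂ) (J : NegSize L η lev₀ 3 𝔸) :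
    ‖LJ ρ τ H C J‖ ≤ ‖ρ‖ * ‖τ‖ *
      ((∑ bb : Bond d Pd, ∑ b' : Bond d Pd, levWeight L η lev₀ 3 bb / levWeight L η lev₀ 3 b'
            * ‖JetSup.evalCLM (𝕜 := ℂ) (levWeight L η lev₀ 1) (levWeight L η lev₁ 2) Dc b'‖
            * ‖single115 (L := L) (η := η) (lev₀ := lev₀) (lev₁ := lev₁) (Dc := Dc) bb‖) * (b * (4 * C₂))) * ‖J‖ := by
  have hw : ∀ b : Bond d Pd, 0 < levWeight L η lev₀ 3 b := levWeight_pos (Fact.out : 0 < L) (Fact.out : 0 < η) lev₀ 3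
  have hκ0 : 0 ≤ ∑ bb : Bond d Pd, ∑ b' : Bond d Pd, levWeight L η lev₀ 3 bb / levWeight L η lev₀ 3 b'
      * ‖JetSup.evalCLM (𝕜 := ℂ) (levWeight L η lev₀ 1) (levWeight L η lev₁ 2) Dc b'‖
      * ‖single115 (L := L) (η := η) (lev₀ := lev₀) (lev₁ := lev₁) (Dc := Dc) bb‖ :=
    Finset.sum_nonneg fun bb _ => Finset.sum_nonneg fun b' _ => by
      have := (hw bb).le; have := (hw b').le; positivity
  have hθ₂ : 0 ≤ (∑ bb : Bond d Pd, ∑ b' : Bond d Pd, levWeight L η lev₀ 3 bb / levWeight L η lev₀ 3 b'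
      * ‖JetSup.evalCLM (𝕜 := ℂ) (levWeight L η lev₀ 1) (levWeight L η lev₁ 2) Dc b'‖
      * ‖single115 (L := L) (η := η) (lev₀ := lev₀) (lev₁ := lev₁) (Dc := Dc) bb‖) * (b * (4 * C₂)) := by
    have := RC.B₀_nonneg; have := RC.C₄_nonneg; positivity
  refine ContinuousLinearMap.opNorm_le_bound _ (by positivity) fun A' => ?_
  have h := norm_LJ_le ρ τ H C J (A' := A') hθ₂ (fun bb => colSum_kernel_fderiv_HquadPart_le RC hC haC A' bb)
  calc ‖LJ ρ τ H C J A'‖ ≤ ‖ρ‖ * ‖τ‖ * _ * ‖J‖ * ‖A'‖ := h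
    _ = _ := by ring

end Slot

/-! ## §3 `‖L_J‖ ≤ K‖J‖` with `K` chosen BEFORE the data -/

section Uniform

variable {𝔸 : Type*} [NormedRing 𝔸] [NormedAlgebra ℂ 𝔸] [FiniteDimensional ℂ 𝔸]
variable {d : ℕ} {Pd : Fin d → ℕ} {L η : ℝ} [Fact (0 < L)] [Fact (0 < η)] {lev₀ : Bond d Pd → ℕ} {κ' : Type*} [Fintype κ']
  {lev₁ : κ' → ℕ}
variable {𝒳 : Type*} [NormedAddCommGroup 𝒳] [NormedSpace ℂ 𝒳]

/-- **THE LINEAR SLOT's SIZE WITH ONE CONSTANT FOR THE WHOLE FAMILY**: for numbers `b, C₂ ≥ 0`, `0 < a_C` (any `ε_C`, `c₄` — the regime is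
quantified inside) and bounds `M_ρ, M_τ, M_D ≥ 0` there is `K ≥ 0` (`K = M_ρM_τ·κ̄(M_D)·4bC₂`) such that for EVERY `∇` with `‖∇g‖ ≤ M_D‖g‖`,
EVERY `H`, `C` in `Regime H 0 C b 0 C₂ c₄ 0 a_C ε_C` with `Prop4Hyp C C₂ c₄`, EVERY `ρ`, `tr` with `‖ρ‖ ≤ M_ρ`, `‖tr‖ ≤ M_τ` and EVERY current `J`:
`‖L_J‖ ≤ K‖J‖₍₋₃₎` — so `‖𝔊 ∘L L_J‖ ≤ C_G·K·‖J‖` and the Λ-slot's contraction follows from `‖J‖ ≤ θ̄∕(C_GK + 1)`, print's (28) read uniformly.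
[cite: Balaban1985Variational, (79) p.290, (28) p.282, (46) p.285] -/
theorem exists_norm_LJ_le_uniform [CompleteSpace 𝒳] [CompleteSpace 𝔸] {b C₂ c₄ aC εC Mρ Mτ MD : ℝ}
    (hb : 0 ≤ b) (hC₂ : 0 ≤ C₂) (haC : 0 < aC) (hMρ : 0 ≤ Mρ) (hMτ : 0 ≤ Mτ) (hMD : 0 ≤ MD) :
    ∃ K : ℝ, 0 ≤ K ∧
      ∀ {Dc : (Bond d Pd → 𝔸) →ₗ[ℂ] (κ' → 𝔸)}, (∀ g : Bond d Pd → 𝔸, ‖Dc g‖ ≤ MD * ‖g‖) →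
      ∀ {H : 𝒳 →L[ℂ] Space115 L η lev₀ lev₁ Dc} {C : Space115 L η lev₀ lev₁ Dc → 𝒳},
        Regime H 0 C b 0 C₂ c₄ 0 aC εC → Prop4Hyp C C₂ c₄ →
      ∀ (ρ : (𝔸 →L[ℂ] ℂ) →L[ℂ] 𝔸) (τ : 𝔸 →L[ℂ] ℂ), ‖ρ‖ ≤ Mρ → ‖τ‖ ≤ Mτ →
      ∀ J : NegSize L η lev₀ 3 𝔸, ‖LJ ρ τ H C J‖ ≤ K * ‖J‖ := by
  set κb : ℝ := ∑ bb : Bond d Pd, ∑ b' : Bond d Pd, levWeight L η lev₀ 3 bb / levWeight L η lev₀ 3 b'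
      * (levWeight L η lev₀ 1 b')⁻¹ * max (levWeight L η lev₀ 1 bb) ((NegSup.wSup (levWeight L η lev₁ 2) : ℝ) * MD) with hκb
  have hw : ∀ b : Bond d Pd, 0 < levWeight L η lev₀ 3 b := levWeight_pos (Fact.out : 0 < L) (Fact.out : 0 < η) lev₀ 3
  have hw1 : ∀ b : Bond d Pd, 0 < levWeight L η lev₀ 1 b := levWeight_pos (Fact.out : 0 < L) (Fact.out : 0 < η) lev₀ 1
  have hκb0 : 0 ≤ κb := Finset.sum_nonneg fun bb _ => Finset.sum_nonneg fun b' _ => by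
    have := (hw bb).le; have := (hw b').le; have := (hw1 b').le
    have : 0 ≤ max (levWeight L η lev₀ 1 bb) ((NegSup.wSup (levWeight L η lev₁ 2) : ℝ) * MD) := le_max_of_le_left (hw1 bb).le
    positivity
  refine ⟨Mρ * Mτ * (κb * (b * (4 * C₂))), by positivity, ?_⟩
  intro Dc hD H C RC hC ρ τ hρ hτ J
  have hκ := colConst_le (L := L) (η := η) (lev₀ := lev₀) (lev₁ := lev₁) (Dc := Dc) hMD hD
  have h := norm_LJ_le_explicit RC hC haC ρ τ J
  refine h.trans ?_
  have hbC : 0 ≤ b * (4 * C₂) := by positivity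
  have hX : (∑ bb : Bond d Pd, ∑ b' : Bond d Pd, levWeight L η lev₀ 3 bb / levWeight L η lev₀ 3 b'
      * ‖JetSup.evalCLM (𝕜 := ℂ) (levWeight L η lev₀ 1) (levWeight L η lev₁ 2) Dc b'‖
      * ‖single115 (L := L) (η := η) (lev₀ := lev₀) (lev₁ := lev₁) (Dc := Dc) bb‖) * (b * (4 * C₂)) ≤ κb * (b * (4 * C₂)) :=
    mul_le_mul_of_nonneg_right hκ hbC
  have hρτ : ‖ρ‖ * ‖τ‖ ≤ Mρ * Mτ := mul_le_mul hρ hτ (norm_nonneg _) hMρ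
  have hS0 : 0 ≤ (∑ bb : Bond d Pd, ∑ b' : Bond d Pd, levWeight L η lev₀ 3 bb / levWeight L η lev₀ 3 b'
      * ‖JetSup.evalCLM (𝕜 := ℂ) (levWeight L η lev₀ 1) (levWeight L η lev₁ 2) Dc b'‖
      * ‖single115 (L := L) (η := η) (lev₀ := lev₀) (lev₁ := lev₁) (Dc := Dc) bb‖) * (b * (4 * C₂)) :=
    mul_nonneg (Finset.sum_nonneg fun bb _ => Finset.sum_nonneg fun b' _ => by
      have := (hw bb).le; have := (hw b').le; positivity) hbC
  have h1 : ‖ρ‖ * ‖τ‖ * ((∑ bb : Bond d Pd, ∑ b' : Bond d Pd, levWeight L η lev₀ 3 bb / levWeight L η lev₀ 3 b'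
      * ‖JetSup.evalCLM (𝕜 := ℂ) (levWeight L η lev₀ 1) (levWeight L η lev₁ 2) Dc b'‖
      * ‖single115 (L := L) (η := η) (lev₀ := lev₀) (lev₁ := lev₁) (Dc := Dc) bb‖) * (b * (4 * C₂)))
      ≤ Mρ * Mτ * (κb * (b * (4 * C₂))) :=
    mul_le_mul hρτ hX hS0 (by positivity)
  exact mul_le_mul_of_nonneg_right h1 (norm_nonneg J)

end Uniform

end Literature.MathematicalPhysics.QuantumFieldTheory.Balaban1983to89.B11Eq79LinearTermUniform

end
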